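import Literature.AlgebraicGeometry.GroupSchemes.CartierDualBlockReduction
import Literature.AlgebraicGeometry.GroupSchemes.EtaleOfCotangentRankZero
import Literature.AlgebraicGeometry.GroupSchemes.TorsionLayerBlockIdempotents
import HarnessLib

/-!
# The block duality `W ≅ 𝒢l^D` cut out of a hermitian perfect duality by a pair of adjoint idempotents; multiplicative blocks from étale conjugates
# ([Tate 1997] §(3.8); [Mumford AV] §20 (I); [Demazure 1972] III §6)

Topic `Literature/AlgebraicGeometry/GroupSchemes`; namespace `Literature.AlgebraicGeometry.GroupSchemes.AffineGroupScheme` (+ `…Motives.AbelianVariety` for the law).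
THEOREMS ONLY (no definition, no named fact, no instance, no notation, no `sorry`).  Cell `hodgecm-mathlib` (D-0151), FLOOR 0, P6 «MOD programme» (crux hLiu418 =
stmt-HodgeConjecture-24832, `--supports`, count-neutral): organ **(C1) FILE 3 «BLOCK DUALITY WITHOUT THE LAGRANGIAN»** (LEAD F0P6-plan (g2) 2026-09-01T21:20:32Z
(C1); GEN census 09be7b9d row (iii) «banal blocks», multiplicative half): the FIRST HALF of ★ (BR) `blockReduction` (B-p04 (g38), p846608) cut free of its
Lagrangian data `Φ` — from a perfect duality `e : G ≅ G^D` and idempotents `εW`, `ε𝒢` with `εW ≫ e = e ≫ ε𝒢^D` (Rosati adjointness of conjugate block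
idempotents `e_ū = e_u^*`), the fixed layers `W`, `𝒢l` are in perfect duality `eW : W ≅ 𝒢l^D`.  USE: for a CONJUGATE PAIR of banal blocks of `A[q]` under the
hermitian Weil–Cartier duality `e₀` of the W-line, «`ū`-block ÉTALE (★ (C1) FILE 2, Lie signature `0`) ⇒ `(u-block)^D` étale ⇒ the `u`-block is of
MULTIPLICATIVE TYPE ⇒ `Ker F_q ∩ (u-block) = (u-block)`» (★ (C1) FILE 1) — the second banal law of (rL), with no Lagrangian input.  HC_CM is proved only
modulo the printed citations until rung 0 closes; this file is generic and changes no count.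

THE MATHEMATICS ([Tate1997FiniteFlatGroupSchemes] §(3.8) pp. 145–146: Cartier duality is an exact contravariant self-equivalence, `Hom(T, G^D)` = characters of
`G_T`; [MumfordAV1970] §20 (I) p. 189: Rosati adjointness `⟨ι(a)x, y⟩ = ⟨x, ι(a†)y⟩`).  With the retractions `rW : G → W`, `r : G → 𝒢l` of the idempotents
(`rW ≫ jW = εW`, `r ≫ j𝒢 = ε𝒢`, from the fixed-layer readings), put `eW := jW ≫ e ≫ j𝒢^D : W → 𝒢l^D` and `eW⁻¹ := r^D ≫ e⁻¹ ≫ rW`; the adjointness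
`εW ≫ e = e ≫ ε𝒢^D` and `jW ≫ εW = jW`, `j𝒢 ≫ ε𝒢 = j𝒢` give `eW ≫ eW⁻¹ = 𝟙` and `eW⁻¹ ≫ eW = 𝟙` (★ `cartierDualMap_comp`, `cartierDualMap_congr`,
`cartierDualMap_id`) — verbatim the first half of ★ `blockReduction`'s proof.  An isomorphism transports étaleness ([Demazure1972] III §6 for the use:
étale dual = multiplicative type, killed by `F^t` when killed by `p^t`, ★ `comp_relFrobeniusOver_eq_one_of_etale_cartierDual_of_id_pow_eq_one`).

* **`exists_blockDuality`** — `∃ eW : W ≅ 𝒢l^D, IsMonHom eW.hom ∧ jW ≫ e.hom ≫ j𝒢^D = eW.hom` (BR's output tokens, no `Φ`).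
* **`etale_cartierDual_of_etale_conjugate`** — with the same data and `W` étale: `𝒢l^D` is étale.
* **`AbelianVariety.comp_comp_comp_relFrobenius_eq_one_of_etale_conjugate`** — the MULTIPLICATIVE BANAL LAW in (BLF) pin currency: for the pin `𝒢l ↪ G ↪ A`,
  `G` killed by `p^r`, and an étale conjugate block `W`: `((t ≫ j𝒢) ≫ j) ≫ F^{(r)}_{A∕k} = 1` for every `T`-point `t` of `𝒢l` (`k = k̄`).

## References
* [Tate1997FiniteFlatGroupSchemes] J. Tate, *Finite flat group schemes*, in: Modular Forms and Fermat's Last Theorem (1997), §(3.8) pp. 145–146, (3.7).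
* [MumfordAV1970] D. Mumford, *Abelian Varieties* (1970), §20 (I) (p. 189).
* [Demazure1972] M. Demazure, *Lectures on p-divisible groups*, LNM 302 (1972), Ch. III §6.
-/

set_option autoImplicit false

-- Mathlib's `Over`/`Scheme` APIs are stated across semireducible wrappers (as in the ★ `GroupSchemes/*` files).
set_option backward.isDefEq.respectTransparency false

universe u

open CategoryTheory CategoryTheory.Limits AlgebraicGeometry MonoidalCategory CartesianMonoidalCategory

noncomputable section

namespace Literature.AlgebraicGeometry.GroupSchemes

namespace AffineGroupScheme

open scoped MonObj

open Literature.AlgebraicGeometry.Motives GroupSchemeKernel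

section BlockDuality

variable {k : Type u} [Field k]
  (G : SchemeOver k) [GrpObj G] [IsCommMonObj G] [IsAffine G.left] [Module.Free k (Alg G)] [Module.Finite k (Alg G)]
  (e : G ≅ cartierDual G) [IsMonHom e.hom]
  (εW ε𝒢 : G ⟶ G) [IsMonHom ε𝒢] (hWW : εW ≫ εW = εW) (h𝒢𝒢 : ε𝒢 ≫ ε𝒢 = ε𝒢)
  (hadj : εW ≫ e.hom = e.hom ≫ cartierDualMap ε𝒢)
  (W : SchemeOver k) [GrpObj W] (jW : W ⟶ G) [IsMonHom jW] [IsClosedImmersion jW.left]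
  (hW : ∀ ⦃T : SchemeOver k⦄ (x : T ⟶ G), (∃ s : T ⟶ W, s ≫ jW = x) ↔ x ≫ εW = x)
  (𝒢l : SchemeOver k) [GrpObj 𝒢l] [IsCommMonObj 𝒢l] [IsAffine 𝒢l.left] [Module.Free k (Alg 𝒢l)] [Module.Finite k (Alg 𝒢l)]
  (j𝒢 : 𝒢l ⟶ G) [IsMonHom j𝒢] [IsClosedImmersion j𝒢.left]
  (h𝒢 : ∀ ⦃T : SchemeOver k⦄ (x : T ⟶ G), (∃ s : T ⟶ 𝒢l, s ≫ j𝒢 = x) ↔ x ≫ ε𝒢 = x)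

include hWW h𝒢𝒢 hadj hW h𝒢 in
/-- **THE BLOCK DUALITY `eW : W ≅ 𝒢l^D`** cut out of a perfect duality `e : G ≅ G^D` (a homomorphism) by idempotent homomorphisms `εW`, `ε𝒢` with the
adjointness `εW ≫ e = e ≫ ε𝒢^D`, for the fixed layers `jW : W ↪ G` of `εW` and `j𝒢 : 𝒢l ↪ G` of `ε𝒢` (readings on `T`-points): `eW := jW ≫ e ≫ j𝒢^D` is a
homomorphism and an ISOMORPHISM (inverse `r^D ≫ e⁻¹ ≫ rW` from the retractions).  The first half of ★ `blockReduction`, without its Lagrangian `Φ`.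
[cite: Tate1997FiniteFlatGroupSchemes, §(3.8) pp. 145–146] [cite: MumfordAV1970, §20 (I) (p. 189)] -/
theorem exists_blockDuality :
    ∃ eW : W ≅ cartierDual 𝒢l, IsMonHom eW.hom ∧ jW ≫ e.hom ≫ cartierDualMap j𝒢 = eW.hom := by
  haveI : Mono jW := Over.mono_of_mono_left _
  haveI : Mono j𝒢 := Over.mono_of_mono_left _
  -- the retractions onto the two fixed layers
  obtain ⟨rW, hrW⟩ := (hW εW).2 hWW
  obtain ⟨r, hr⟩ := (h𝒢 ε𝒢).2 h𝒢𝒢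
  have hjWεW : jW ≫ εW = jW := (hW jW).1 ⟨𝟙 W, Category.id_comp _⟩
  have hj𝒢ε𝒢 : j𝒢 ≫ ε𝒢 = j𝒢 := (h𝒢 j𝒢).1 ⟨𝟙 𝒢l, Category.id_comp _⟩
  have hjWrW : jW ≫ rW = 𝟙 W := by rw [← cancel_mono jW, Category.assoc, hrW, hjWεW, Category.id_comp]
  have hj𝒢r : j𝒢 ≫ r = 𝟙 𝒢l := by rw [← cancel_mono j𝒢, Category.assoc, hr, hj𝒢ε𝒢, Category.id_comp]
  haveI : IsMonHom (r ≫ j𝒢) := by rw [hr]; infer_instance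
  haveI : IsMonHom r := isMonHom_of_comp_mono r j𝒢
  -- the adjunction composed with the fixed layer `W`
  have hadj1 : jW ≫ e.hom ≫ cartierDualMap ε𝒢 = jW ≫ e.hom := by
    rw [← hadj, ← Category.assoc, hjWεW]
  -- the candidate inverse and the two identities
  have hcomp1 : cartierDualMap j𝒢 ≫ cartierDualMap r = cartierDualMap ε𝒢 := by
    rw [← cartierDualMap_comp, cartierDualMap_congr hr]
  have hcomp2 : cartierDualMap ε𝒢 ≫ cartierDualMap j𝒢 = cartierDualMap j𝒢 := by
    rw [← cartierDualMap_comp, cartierDualMap_congr hj𝒢ε𝒢]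
  have hcomp3 : cartierDualMap r ≫ cartierDualMap j𝒢 = 𝟙 _ := by
    rw [← cartierDualMap_comp, cartierDualMap_congr hj𝒢r, cartierDualMap_id]
  have hinv1 : (jW ≫ e.hom ≫ cartierDualMap j𝒢) ≫ (cartierDualMap r ≫ e.inv ≫ rW) = 𝟙 W := by
    simp only [Category.assoc]
    rw [← Category.assoc (cartierDualMap j𝒢), hcomp1, ← Category.assoc e.hom, ← Category.assoc jW, ← Category.assoc jW]
    rw [show (jW ≫ e.hom) ≫ cartierDualMap ε𝒢 = jW ≫ e.hom ≫ cartierDualMap ε𝒢 from Category.assoc _ _ _, hadj1, Category.assoc,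
      Iso.hom_inv_id_assoc, hjWrW]
  have hinv2 : (cartierDualMap r ≫ e.inv ≫ rW) ≫ (jW ≫ e.hom ≫ cartierDualMap j𝒢) = 𝟙 _ := by
    simp only [Category.assoc]
    rw [← Category.assoc rW jW, hrW, ← Category.assoc εW e.hom, hadj, Category.assoc, Iso.inv_hom_id_assoc, hcomp2, hcomp3]
  refine ⟨⟨jW ≫ e.hom ≫ cartierDualMap j𝒢, cartierDualMap r ≫ e.inv ≫ rW, hinv1, hinv2⟩, ?_, rfl⟩
  change IsMonHom (jW ≫ e.hom ≫ cartierDualMap j𝒢)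
  infer_instance

include hWW h𝒢𝒢 hadj hW h𝒢 in
/-- **AN ÉTALE CONJUGATE BLOCK MAKES THE BLOCK OF MULTIPLICATIVE TYPE**: with the data of `exists_blockDuality`, if `W` is étale then the Cartier dual
`𝒢l^D` is étale (`W ≅ 𝒢l^D`, ★ `etale_hom_of_iso`). [cite: Tate1997FiniteFlatGroupSchemes, §(3.8) pp. 145–146, (3.7)] [cite: Demazure1972, Ch. III §6] -/
theorem etale_cartierDual_of_etale_conjugate [Etale W.hom] : Etale (cartierDual 𝒢l).hom := by
  obtain ⟨eW, -, -⟩ := exists_blockDuality G e εW ε𝒢 hWW h𝒢𝒢 hadj W jW hW 𝒢l j𝒢 h𝒢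
  exact etale_hom_of_iso eW

end BlockDuality

end AffineGroupScheme

end Literature.AlgebraicGeometry.GroupSchemes

namespace Literature.AlgebraicGeometry.Motives.AbelianVariety

open Literature.AlgebraicGeometry.GroupSchemes Literature.AlgebraicGeometry.GroupSchemes.AffineGroupScheme
open scoped MonObj

/-- **THE MULTIPLICATIVE BANAL LAW FROM AN ÉTALE CONJUGATE BLOCK, (BLF) pin currency.**  `k = k̄` of exponential characteristic `p`; `j : G ↪ A` a closed
subgroup of an abelian variety killed by `p^r` (`(𝟙 G)^{p^r} = 1`, e.g. `G = A[p^r]`) carrying a perfect duality `e : G ≅ G^D` (the W-line's Weil–Cartier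
duality); `εW`, `ε𝒢` idempotent homomorphisms with `εW ≫ e = e ≫ ε𝒢^D` (conjugate block idempotents, Rosati); `W`, `𝒢l` their fixed layers.  If `W` is ÉTALE
(★ (C1) FILE 2: Lie signature `0` at `ū`), every `T`-point `t` of `𝒢l` satisfies `((t ≫ j𝒢) ≫ j) ≫ F^{(r)}_{A∕k} = 1` — «`Ker F_q ∩ (u-block) = (u-block)`», the
`law` input of ★ (E2-asm) `AbelianVarietyKernelLawBlockAssembly` on a multiplicative banal block. [cite: Demazure1972, Ch. III §6]
[cite: Tate1997FiniteFlatGroupSchemes, §(3.8) pp. 145–146, (3.7)] [cite: MumfordAV1970, §20 (I) (p. 189)] -/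
theorem comp_comp_comp_relFrobenius_eq_one_of_etale_conjugate {k : Type u} [Field k] [IsAlgClosed k] (p : ℕ) [ExpChar k p] (r : ℕ) (A : AbelianVariety k)
    (G : SchemeOver k) [GrpObj G] [IsCommMonObj G] [IsAffine G.left] [Module.Free k (Alg G)] [Module.Finite k (Alg G)]
    (j : G ⟶ A.X) [IsMonHom j] (hq : (𝟙 G) ^ p ^ r = 1)
    (e : G ≅ cartierDual G) [IsMonHom e.hom]
    (εW ε𝒢 : G ⟶ G) [IsMonHom ε𝒢] (hWW : εW ≫ εW = εW) (h𝒢𝒢 : ε𝒢 ≫ ε𝒢 = ε𝒢)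
    (hadj : εW ≫ e.hom = e.hom ≫ cartierDualMap ε𝒢)
    (W : SchemeOver k) [GrpObj W] (jW : W ⟶ G) [IsMonHom jW] [IsClosedImmersion jW.left] [Etale W.hom]
    (hW : ∀ ⦃T : SchemeOver k⦄ (x : T ⟶ G), (∃ s : T ⟶ W, s ≫ jW = x) ↔ x ≫ εW = x)
    (𝒢l : SchemeOver k) [GrpObj 𝒢l] [IsCommMonObj 𝒢l] [IsAffine 𝒢l.left] [Module.Free k (Alg 𝒢l)] [Module.Finite k (Alg 𝒢l)]
    (j𝒢 : 𝒢l ⟶ G) [IsMonHom j𝒢] [IsClosedImmersion j𝒢.left]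
    (h𝒢 : ∀ ⦃T : SchemeOver k⦄ (x : T ⟶ G), (∃ s : T ⟶ 𝒢l, s ≫ j𝒢 = x) ↔ x ≫ ε𝒢 = x)
    {T : SchemeOver k} (t : T ⟶ 𝒢l) :
    ((t ≫ j𝒢) ≫ j) ≫ (A.relFrobenius p r).hom.hom.hom = 1 := by
  haveI : Etale (cartierDual 𝒢l).hom := etale_cartierDual_of_etale_conjugate G e εW ε𝒢 hWW h𝒢𝒢 hadj W jW hW 𝒢l j𝒢 h𝒢
  haveI : Mono j𝒢 := Over.mono_of_mono_left _
  have hq' : (𝟙 𝒢l) ^ p ^ r = 1 :=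
    TorsionLayer.pow_id_eq_one_of_layer j𝒢 (by rw [hq, MonObj.comp_one])
  rw [Category.assoc t]
  exact A.comp_comp_relFrobenius_eq_one_of_etale_cartierDual p r (j𝒢 ≫ j) hq' t

end Literature.AlgebraicGeometry.Motives.AbelianVariety

end
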